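import Summits.AtomisticToContinuum.HydrodynamicLimit.Theorems.JParityClosureParityBandClosureWindowCovarianceIsotropyB
import HarnessLib

/-!
# Window covariance isotropy (crux `JParityClosure.ParityBandClosure`, stmt-AtomisticToContinuum-17608, line
# `transfer-weighted-parity-chain`, stub `stub_windowCovarianceIsotropy`) — helper C: the two-time floor functional

WHAT.  The EXACT identity between the two-time reference functional `B_w` of `RateFloorPW` (products of the
empirical measures at two times, taken AFTER space–time windowing, tested against `cone ⊗ cone ⊗ Θ`, `Θ` the
sphere-integrated mark) and the floor functional of `ParityStability` on the normalised window law: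
`B_w = ρ_w² ∫ Ξ B d((ν_w ⊗ ν_w) ⊗ σ)` (`floorFunctional_eq`).  Ingredients: integration against the product of two
empirical measures (`integral_prod_empiricalMeasure₂`), double integration against the window law of helper A
(`integral_integral_wlaw`, Fubini in time with the finite particle sums pulled through), the a.e. velocity bound along
`ν_w ⊗ ν_w (⊗ σ)` from energy conservation, and Fubini on `(ν_w ⊗ ν_w) ⊗ σ`.

REFERENCES.  H. Spohn, *Large Scale Dynamics of Interacting Particles* (1991), Part I §3; elementary measure theory
(Mathlib `MeasureTheory.integral_prod`).  No named fact is invoked.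
-/

noncomputable section

namespace Summit.AtomisticToContinuum.HydrodynamicLimit.Theorems.ParityBandClosureWindowCovariance

open scoped BigOperators Topology Classical MeasureTheory ENNReal InnerProductSpace
open Filter Set MeasureTheory Function Topology
open Literature.MathematicalPhysics.KineticTheory
open Literature.Analysis.FluidPDE
open Summit.AtomisticToContinuum.HydrodynamicLimit.Theorems.LocalSecondLawNegative (cone cone_nonneg cone_le
  continuous_cone integral_cone_le)

variable {N : ℕ}

section Window

variable {ε r τ t₀ : ℝ} {x₀ : T3} {γ : ℝ → Config (N + 1) (Fin 3) T3}

/-- Integration against the product of two (possibly different) empirical measures is the normalised double sum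
(adapted from `integral_prod_empiricalMeasure_eq_sum`, same configuration twice). [folklore] -/
theorem integral_prod_empiricalMeasure₂ (z z' : Config (N + 1) (Fin 3) T3) (F : (T3 × V3) × (T3 × V3) → ℝ) :
    ∫ p, F p ∂((empiricalMeasure z).prod (empiricalMeasure z')) =
      ((N + 1 : ℕ) : ℝ)⁻¹ * ((N + 1 : ℕ) : ℝ)⁻¹ * ∑ i, ∑ j, F (z i, z' j) := by
  haveI : MeasurableSingletonClass ((T3 × V3) × (T3 × V3)) := Prod.instMeasurableSingletonClass
  have hprod : (empiricalMeasure z).prod (empiricalMeasure z') =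
      (((N + 1 : ℕ) : ℝ≥0∞)⁻¹ * ((N + 1 : ℕ) : ℝ≥0∞)⁻¹) •
        Measure.sum (fun p : Fin (N + 1) × Fin (N + 1) => Measure.dirac (z p.1, z' p.2)) := by
    rw [empiricalMeasure_eq, empiricalMeasure_eq, ← Measure.sum_fintype, ← Measure.sum_fintype,
      Measure.prod_smul_left, Measure.prod_smul_right, smul_smul, Measure.prod_sum]
    congr 1
    congr 1
    funext p
    exact Measure.dirac_prod_dirac
  rw [hprod, integral_smul_measure, Measure.sum_fintype,
    integral_finsetSum_measure fun p _ => integrable_dirac (by simp)]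
  simp only [integral_dirac, smul_eq_mul, ENNReal.toReal_mul, ENNReal.toReal_inv,
    ENNReal.toReal_natCast, Fintype.sum_prod_type]

/-- Sup bound of the sphere-integrated mark of a bounded mark: `|Θ v w| ≤ |S²| C (‖v‖ + ‖w‖)`. [folklore] -/
theorem abs_sphereMark_le {Ξt : V3 × V3 × V3 → ℝ} {C : ℝ} (hC : ∀ p, |Ξt p| ≤ C) (v w : V3) :
    |sphereMark Ξt v w| ≤ sphereMeasure.real (Set.univ : Set (Metric.sphere (0 : V3) 1)) * (C * (‖v‖ + ‖w‖)) := by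
  refine abs_sphereMark_le_of_forall_le fun ω => ?_
  have hk := hardSphereKernel_nonneg_le v w ω
  rw [abs_mul, abs_of_nonneg hk.1]
  have h1 : |Ξt ((ω : V3), v, w)| ≤ C := hC _
  have h2 : hardSphereKernel (w, v) ω ≤ ‖v‖ + ‖w‖ := hk.2.trans ((norm_sub_le w v).trans_eq (add_comm _ _))
  exact mul_le_mul h1 h2 hk.1 ((abs_nonneg _).trans h1)

/-- The cone kernel is bounded by its peak `3/(πr³)`. [folklore] -/
theorem cone_le_peak (hr : 0 < r) (y x : T3) : cone r y x ≤ 3 / (Real.pi * r ^ 3) := by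
  refine (cone_le hr y x).trans (mul_le_of_le_one_right (by positivity) ?_)
  by_cases hx : x ∈ {x' : T3 | Torus.euclidDist x' y < r}
  · rw [Set.indicator_of_mem hx]
  · rw [Set.indicator_of_notMem hx]; exact zero_le_one

/-- **Double integration against the window law** of a continuous pair observable bounded on the velocity ball:
`∫∫ F(v, w) dλ_w(w) dλ_w(v)` is the two-time `btent ⊗ btent`-weighted normalised double sum. [folklore] -/
theorem integral_integral_wlaw (hr : 0 < r) (hγ : Measurable γ) {R : ℝ} (hR : ∀ s k, ‖(γ s k).2‖ ≤ R)
    {F : V3 → V3 → ℝ} (hF : Continuous fun p : V3 × V3 => F p.1 p.2) {K : ℝ}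
    (hK : ∀ v w, ‖v‖ ≤ R → ‖w‖ ≤ R → |F v w| ≤ K) :
    ∫ v, ∫ w, F v w ∂(wlaw r τ t₀ x₀ γ) ∂(wlaw r τ t₀ x₀ γ) =
      ∫ s₁ in Set.Icc 0 τ, ∫ s₂ in Set.Icc 0 τ, btent r (s₁ - t₀) * btent r (s₂ - t₀) *
        (((N + 1 : ℕ) : ℝ)⁻¹ * ((N + 1 : ℕ) : ℝ)⁻¹ *
          ∑ i, ∑ k, cone r (γ s₁ i).1 x₀ * cone r (γ s₂ k).1 x₀ * F (γ s₁ i).2 (γ s₂ k).2) := by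
  have hvk : ∀ k : Fin (N + 1), Measurable fun s : ℝ => (γ s k).2 := fun k => ((measurable_pi_apply k).comp hγ).snd
  have hxk : ∀ k : Fin (N + 1), Measurable fun s : ℝ => (γ s k).1 := fun k => ((measurable_pi_apply k).comp hγ).fst
  have hR0 : 0 ≤ R := (norm_nonneg _).trans (hR 0 0)
  -- the inner integral in closed form
  set G : V3 → ℝ := fun v => ∫ s₂ in Set.Icc 0 τ, btent r (s₂ - t₀) *
    (((N + 1 : ℕ) : ℝ)⁻¹ * ∑ k, cone r (γ s₂ k).1 x₀ * F v (γ s₂ k).2) with hGdef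
  have hinner : ∀ v, ‖v‖ ≤ R → ∫ w, F v w ∂(wlaw r τ t₀ x₀ γ) = G v := by
    intro v hv
    have hFv : Measurable (F v) := (hF.comp (continuous_const.prodMk continuous_id)).measurable
    rw [integral_wlaw hr hγ hFv (C := K) (fun s k => hK v _ hv (hR s k))]
    refine integral_congr_ae (Eventually.of_forall fun s => ?_)
    show btent r (s - t₀) * ∫ q, cone r q.1 x₀ * F v q.2 ∂(empiricalMeasure (γ s)) = _
    rw [integral_empiricalMeasure]
  -- joint measurability of the integrand of `G`
  have hjm : Measurable fun p : V3 × ℝ => btent r (p.2 - t₀) *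
      (((N + 1 : ℕ) : ℝ)⁻¹ * ∑ k, cone r (γ p.2 k).1 x₀ * F p.1 (γ p.2 k).2) := by
    have h1 : Measurable fun p : V3 × ℝ => btent r (p.2 - t₀) :=
      (continuous_btent r).measurable.comp (measurable_snd.sub measurable_const)
    refine h1.mul (measurable_const.mul (Finset.measurable_sum _ fun k _ => ?_))
    have h2 : Measurable fun p : V3 × ℝ => cone r (γ p.2 k).1 x₀ :=
      measurable_cone_comp r ((hxk k).comp measurable_snd) measurable_const
    have h3 : Measurable fun p : V3 × ℝ => F p.1 (γ p.2 k).2 :=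
      hF.measurable.comp (measurable_fst.prodMk ((hvk k).comp measurable_snd))
    exact h2.mul h3
  have hGm : Measurable G := by
    have h := (hjm.stronglyMeasurable.integral_prod_right' (ν := volume.restrict (Set.Icc (0 : ℝ) τ))).measurable
    exact h
  -- a bound for `G` on the velocity ball
  set B : ℝ := (r ^ 2)⁻¹ * (((N + 1 : ℕ) : ℝ)⁻¹ * ∑ _k : Fin (N + 1), 3 / (Real.pi * r ^ 3) * K) with hBdef
  have hGb : ∀ v, ‖v‖ ≤ R → |G v| ≤ B * (volume (Set.Icc (0 : ℝ) τ)).toReal := by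
    intro v hv
    have hb : ∀ s, ‖btent r (s - t₀) * (((N + 1 : ℕ) : ℝ)⁻¹ * ∑ k, cone r (γ s k).1 x₀ * F v (γ s k).2)‖ ≤ B := by
      intro s
      rw [norm_mul, Real.norm_eq_abs, Real.norm_eq_abs, abs_of_nonneg (btent_nonneg _ _), abs_mul,
        abs_of_nonneg (by positivity : (0 : ℝ) ≤ ((N + 1 : ℕ) : ℝ)⁻¹)]
      refine mul_le_mul (btent_le _ _) (mul_le_mul_of_nonneg_left ((Finset.abs_sum_le_sum_abs _ _).trans
        (Finset.sum_le_sum fun k _ => ?_)) (by positivity)) (by positivity) (by positivity)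
      rw [abs_mul, abs_of_nonneg (cone_nonneg hr _ _)]
      exact mul_le_mul (cone_le_peak hr _ _) (hK v _ hv (hR s k)) (abs_nonneg _) (by positivity)
    have h := norm_setIntegral_le_of_norm_le_const (s := Set.Icc (0 : ℝ) τ) (by
      rw [Real.volume_Icc]; exact ENNReal.ofReal_lt_top) (fun s _ => hb s)
    rw [Real.norm_eq_abs, measureReal_def] at h
    exact h
  -- the outer integral
  have hout : ∫ v, ∫ w, F v w ∂(wlaw r τ t₀ x₀ γ) ∂(wlaw r τ t₀ x₀ γ) = ∫ v, G v ∂(wlaw r τ t₀ x₀ γ) := by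
    refine integral_congr_ae ?_
    filter_upwards [ae_wlaw_norm_le (r := r) (τ := τ) (t₀ := t₀) (x₀ := x₀) hγ hR] with v hv
    exact hinner v hv
  rw [hout, integral_wlaw hr hγ hGm (fun s k => hGb _ (hR s k))]
  refine integral_congr_ae (Eventually.of_forall fun s₁ => ?_)
  show btent r (s₁ - t₀) * ∫ q, cone r q.1 x₀ * G q.2 ∂(empiricalMeasure (γ s₁)) = _
  rw [integral_empiricalMeasure, hGdef]
  simp only []
  -- pull the finite sum and the constants inside the `s₂`-integral
  have hint : ∀ i : Fin (N + 1), Integrable (fun s₂ => btent r (s₂ - t₀) *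
      (((N + 1 : ℕ) : ℝ)⁻¹ * ∑ k, cone r (γ s₂ k).1 x₀ * F (γ s₁ i).2 (γ s₂ k).2))
      (volume.restrict (Set.Icc (0 : ℝ) τ)) := by
    intro i
    refine Measure.integrableOn_of_bounded (M := B) (by rw [Real.volume_Icc]; exact ENNReal.ofReal_ne_top)
      ((hjm.comp (measurable_const.prodMk measurable_id)).aestronglyMeasurable) (ae_of_all _ fun s₂ => ?_)
    · rw [norm_mul, Real.norm_eq_abs, Real.norm_eq_abs, abs_of_nonneg (btent_nonneg _ _), abs_mul,
        abs_of_nonneg (by positivity : (0 : ℝ) ≤ ((N + 1 : ℕ) : ℝ)⁻¹)]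
      refine mul_le_mul (btent_le _ _) (mul_le_mul_of_nonneg_left ((Finset.abs_sum_le_sum_abs _ _).trans
        (Finset.sum_le_sum fun k _ => ?_)) (by positivity)) (by positivity) (by positivity)
      rw [abs_mul, abs_of_nonneg (cone_nonneg hr _ _)]
      exact mul_le_mul (cone_le_peak hr _ _) (hK _ _ (hR s₁ i) (hR s₂ k)) (abs_nonneg _) (by positivity)
  rw [Finset.mul_sum, Finset.mul_sum]
  simp_rw [← integral_const_mul]
  rw [← integral_finsetSum _ fun i _ => (((hint i).const_mul _).const_mul _).const_mul _]
  refine integral_congr_ae (Eventually.of_forall fun s₂ => ?_)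
  simp only [Finset.mul_sum]
  refine Finset.sum_congr rfl fun i _ => Finset.sum_congr rfl fun k _ => ?_
  ring

/-- Along the normalised window law of a hard-sphere trajectory, a.e. velocity is bounded by the energy bound
`R = √(2E(γ 0))`, and so are both velocities along `ν_w ⊗ ν_w` and `(ν_w ⊗ ν_w) ⊗ σ`. [folklore] -/
theorem ae_nlaw_prod_prod_norm_le (hγ : IsHardSphereTrajectory (Torus.geometry (Fin 3)) ε (N + 1) γ) (c : ℝ≥0∞)
    (μ : Measure (Metric.sphere (0 : V3) 1)) [SFinite μ] [SFinite (c • wlaw r τ t₀ x₀ γ)] :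
    (∀ᵐ vw ∂((c • wlaw r τ t₀ x₀ γ).prod (c • wlaw r τ t₀ x₀ γ)),
      ‖vw.1‖ ≤ Real.sqrt (2 * configEnergy (γ 0)) ∧ ‖vw.2‖ ≤ Real.sqrt (2 * configEnergy (γ 0))) ∧
    ∀ᵐ q ∂(((c • wlaw r τ t₀ x₀ γ).prod (c • wlaw r τ t₀ x₀ γ)).prod μ),
      ‖q.1.1‖ ≤ Real.sqrt (2 * configEnergy (γ 0)) ∧ ‖q.1.2‖ ≤ Real.sqrt (2 * configEnergy (γ 0)) := by
  set R := Real.sqrt (2 * configEnergy (γ 0)) with hRdef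
  have hR : ∀ s k, ‖(γ s k).2‖ ≤ R := norm_vel_le_sqrt_of_isHardSphereTrajectory hγ
  have h1 : ∀ᵐ v ∂(c • wlaw r τ t₀ x₀ γ), ‖v‖ ≤ R :=
    Measure.ae_smul_measure (ae_wlaw_norm_le (r := r) (τ := τ) (t₀ := t₀) (x₀ := x₀) hγ.measurable_torus hR) c
  have hm : MeasurableSet {vw : V3 × V3 | ‖vw.1‖ ≤ R ∧ ‖vw.2‖ ≤ R} :=
    (measurableSet_le measurable_fst.norm measurable_const).inter
      (measurableSet_le measurable_snd.norm measurable_const)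
  have h2 : ∀ᵐ vw ∂((c • wlaw r τ t₀ x₀ γ).prod (c • wlaw r τ t₀ x₀ γ)), ‖vw.1‖ ≤ R ∧ ‖vw.2‖ ≤ R := by
    rw [Measure.ae_prod_iff_ae_ae hm]
    filter_upwards [h1] with v hv
    filter_upwards [h1] with w hw
    exact ⟨hv, hw⟩
  refine ⟨h2, ?_⟩
  have hm' : MeasurableSet {q : (V3 × V3) × Metric.sphere (0 : V3) 1 | ‖q.1.1‖ ≤ R ∧ ‖q.1.2‖ ≤ R} :=
    (measurableSet_le measurable_fst.fst.norm measurable_const).inter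
      (measurableSet_le measurable_fst.snd.norm measurable_const)
  rw [Measure.ae_prod_iff_ae_ae hm']
  filter_upwards [h2] with vw hvw
  exact ae_of_all _ fun _ => hvw

/-- **The two-time reference functional of `RateFloorPW` IS `ρ_w² ∫ Ξ B d((ν_w ⊗ ν_w) ⊗ σ)`**: the `btent ⊗ btent`
-weighted product of the empirical measures at two times, tested against `cone ⊗ cone ⊗ Θ`, is the product of the
window law with itself tested against the sphere-integrated mark `Θ`, and Fubini. [folklore] -/
theorem floorFunctional_eq (hγ : IsHardSphereTrajectory (Torus.geometry (Fin 3)) ε (N + 1) γ) (hr : 0 < r)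
    {ρ : ℝ}
    (hρ : ρ = ∫ s in Set.Icc 0 τ, btent r (s - t₀) * ∫ q, cone r q.1 x₀ ∂(empiricalMeasure (γ s))) (hρ0 : 0 < ρ)
    {Ξ : (V3 × V3) × Metric.sphere (0 : V3) 1 → ℝ} (hΞc : Continuous Ξ) {C : ℝ} (hΞb : ∀ q, |Ξ q| ≤ C)
    {Ξt : V3 × V3 × V3 → ℝ} (hΞtc : Continuous Ξt) {Ct : ℝ} (hΞtb : ∀ p, |Ξt p| ≤ Ct)
    (hΞ : ∀ (n v w : V3) (hn : ‖n‖ = 1), Ξt (n, v, w) = Ξ ((v, w), ⟨n, mem_sphere_zero_iff_norm.2 hn⟩)) :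
    (∫ s₁ in Set.Icc 0 τ, ∫ s₂ in Set.Icc 0 τ, btent r (s₁ - t₀) * btent r (s₂ - t₀) *
        ∫ p, cone r p.1.1 x₀ * cone r p.2.1 x₀ * sphereMark Ξt p.1.2 p.2.2
          ∂((empiricalMeasure (γ s₁)).prod (empiricalMeasure (γ s₂)))) =
      ρ ^ 2 * ∫ q, Ξ q * hardSphereKernel (q.1.2, q.1.1) q.2
        ∂((((ENNReal.ofReal ρ)⁻¹ • wlaw r τ t₀ x₀ γ).prod ((ENNReal.ofReal ρ)⁻¹ • wlaw r τ t₀ x₀ γ)).prod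
          sphereMeasure) := by
  haveI := isProbabilityMeasure_nlaw (τ := τ) (t₀ := t₀) (x₀ := x₀) hr hγ.measurable_torus hρ hρ0
  haveI := isFiniteMeasure_wlaw (N := N) (τ := τ) (t₀ := t₀) (x₀ := x₀) (γ := γ) hr
  haveI := isFiniteMeasure_sphereMeasure_V3
  set R := Real.sqrt (2 * configEnergy (γ 0)) with hRdef
  have hR : ∀ s k, ‖(γ s k).2‖ ≤ R := norm_vel_le_sqrt_of_isHardSphereTrajectory hγ
  have hR0 : 0 ≤ R := Real.sqrt_nonneg _
  set Sm := sphereMeasure.real (Set.univ : Set (Metric.sphere (0 : V3) 1)) with hSm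
  have hC0 : 0 ≤ C := (abs_nonneg _).trans (hΞb ((0, 0), toSph 0))
  have hΘc : Continuous fun p : V3 × V3 => sphereMark Ξt p.1 p.2 := continuous_sphereMark_uncurry hΞtc
  have hΘb : ∀ v w, ‖v‖ ≤ R → ‖w‖ ≤ R → |sphereMark Ξt v w| ≤ Sm * (Ct * (R + R)) := fun v w hv hw =>
    (abs_sphereMark_le hΞtb v w).trans (mul_le_mul_of_nonneg_left
      (mul_le_mul_of_nonneg_left (add_le_add hv hw) ((abs_nonneg _).trans (hΞtb 0))) measureReal_nonneg)
  obtain ⟨hae2, hae3⟩ := ae_nlaw_prod_prod_norm_le (r := r) (τ := τ) (t₀ := t₀) (x₀ := x₀) hγ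
    (ENNReal.ofReal ρ)⁻¹ sphereMeasure
  -- ### left-hand side: the double window-law integral of `Θ`
  have hL : (∫ s₁ in Set.Icc 0 τ, ∫ s₂ in Set.Icc 0 τ, btent r (s₁ - t₀) * btent r (s₂ - t₀) *
      ∫ p, cone r p.1.1 x₀ * cone r p.2.1 x₀ * sphereMark Ξt p.1.2 p.2.2
        ∂((empiricalMeasure (γ s₁)).prod (empiricalMeasure (γ s₂)))) =
      ∫ v, ∫ w, sphereMark Ξt v w ∂(wlaw r τ t₀ x₀ γ) ∂(wlaw r τ t₀ x₀ γ) := by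
    rw [integral_integral_wlaw hr hγ.measurable_torus hR hΘc hΘb]
    refine integral_congr_ae (Eventually.of_forall fun s₁ => integral_congr_ae (Eventually.of_forall fun s₂ => ?_))
    show btent r (s₁ - t₀) * btent r (s₂ - t₀) *
      ∫ p, cone r p.1.1 x₀ * cone r p.2.1 x₀ * sphereMark Ξt p.1.2 p.2.2
        ∂((empiricalMeasure (γ s₁)).prod (empiricalMeasure (γ s₂))) = _
    rw [integral_prod_empiricalMeasure₂]
  -- ### right-hand side: Fubini on `(ν ⊗ ν) ⊗ σ`
  have hGc : Continuous fun q : (V3 × V3) × Metric.sphere (0 : V3) 1 => Ξ q * hardSphereKernel (q.1.2, q.1.1) q.2 := by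
    refine hΞc.mul ?_
    unfold hardSphereKernel
    fun_prop
  have hint3 : Integrable (fun q : (V3 × V3) × Metric.sphere (0 : V3) 1 => Ξ q * hardSphereKernel (q.1.2, q.1.1) q.2)
      ((((ENNReal.ofReal ρ)⁻¹ • wlaw r τ t₀ x₀ γ).prod ((ENNReal.ofReal ρ)⁻¹ • wlaw r τ t₀ x₀ γ)).prod
        sphereMeasure) := by
    refine Integrable.mono' (integrable_const (C * (R + R))) hGc.aestronglyMeasurable ?_
    filter_upwards [hae3] with q hq
    have hk := hardSphereKernel_nonneg_le q.1.1 q.1.2 q.2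
    rw [Real.norm_eq_abs, abs_mul, abs_of_nonneg hk.1]
    refine mul_le_mul (hΞb q) (hk.2.trans ((norm_sub_le _ _).trans ?_)) hk.1 hC0
    linarith [hq.1, hq.2]
  have hint2 : Integrable (fun vw : V3 × V3 => sphereMark Ξt vw.1 vw.2)
      (((ENNReal.ofReal ρ)⁻¹ • wlaw r τ t₀ x₀ γ).prod ((ENNReal.ofReal ρ)⁻¹ • wlaw r τ t₀ x₀ γ)) := by
    refine Integrable.mono' (integrable_const (Sm * (Ct * (R + R)))) hΘc.aestronglyMeasurable ?_
    filter_upwards [hae2] with vw hvw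
    rw [Real.norm_eq_abs]
    exact hΘb _ _ hvw.1 hvw.2
  have hsph : ∀ vw : V3 × V3, (∫ ω, Ξ (vw, ω) * hardSphereKernel (vw.2, vw.1) ω ∂sphereMeasure) =
      sphereMark Ξt vw.1 vw.2 := by
    intro vw
    unfold sphereMark
    refine integral_congr_ae (Eventually.of_forall fun ω => ?_)
    have hω : ‖(ω : V3)‖ = 1 := norm_coe_unitSphere ω
    show Ξ (vw, ω) * hardSphereKernel (vw.2, vw.1) ω = Ξt ((ω : V3), vw.1, vw.2) * hardSphereKernel (vw.2, vw.1) ω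
    rw [hΞ _ _ _ hω]
  have hRHS : (∫ q, Ξ q * hardSphereKernel (q.1.2, q.1.1) q.2
      ∂((((ENNReal.ofReal ρ)⁻¹ • wlaw r τ t₀ x₀ γ).prod ((ENNReal.ofReal ρ)⁻¹ • wlaw r τ t₀ x₀ γ)).prod
        sphereMeasure)) =
      ρ⁻¹ * (ρ⁻¹ * ∫ v, ∫ w, sphereMark Ξt v w ∂(wlaw r τ t₀ x₀ γ) ∂(wlaw r τ t₀ x₀ γ)) := by
    rw [integral_prod _ hint3]
    simp_rw [hsph]
    rw [integral_prod _ hint2, integral_nlaw hρ0.le]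
    congr 1
    simp_rw [integral_nlaw (r := r) (τ := τ) (t₀ := t₀) (x₀ := x₀) (γ := γ) hρ0.le]
    exact integral_const_mul _ _
  rw [hL, hRHS]
  field_simp

/-- **Registered sub-goal `stub_wciEmpiricalProduct` (helper C of `stub_windowCovarianceIsotropy`): integration
against the product of two empirical measures is the normalised double sum** (the finite-`N` core of "products taken
after windowing"). [folklore] -/
theorem stub_wciEmpiricalProduct : ∀ {N : ℕ} (z z' : Config (N + 1) (Fin 3) T3) (F : (T3 × V3) × (T3 × V3) → ℝ), ∫ p, F p ∂((empiricalMeasure z).prod (empiricalMeasure z')) = ((N + 1 : ℕ) : ℝ)⁻¹ * ((N + 1 : ℕ) : ℝ)⁻¹ * ∑ i, ∑ j, F (z i, z' j) :=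
  fun z z' F => integral_prod_empiricalMeasure₂ z z' F

end Window

end Summit.AtomisticToContinuum.HydrodynamicLimit.Theorems.ParityBandClosureWindowCovariance

end
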